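import Literature.Topology.FourManifolds.SimplifiedBrokenLefschetzMorseCharts
import Literature.Topology.FourManifolds.MorseChartChangeInterior
import Literature.Topology.FourManifolds.MorseExtrema
import HarnessLib

/-!
# Height functions at a Lefschetz critical point: a nondegenerate critical point of index `2`,
# on total spaces with boundary (any model with corners on `ℝ⁴`) over any base

Topic `Literature/Topology/FourManifolds` (Morse theory of Lefschetz fibrations; written for the
Morse-theoretic reading of Kas' handlebody of a positive allowable Lefschetz fibration over the
disc — Kas 1980, Lemma 1.6 and Thm. 1.7; Gompf–Stipsicz 1999, §8.2: *each singular fibre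
contributes one `2`-handle* — whose total spaces are compact 4-manifolds WITH boundary, model
`𝓡∂ 4`, fibred over the closed disc `𝔻² ⊂ ℝ²`; consumers: the PALF vocabulary
`Literature/Geometry/Symplectic/SteinPALF.lean` and the reductions of Oba 2016, Thm. 1.1 in
`Literature/Geometry/Symplectic/PlanarHomologySphereFillingsPALF.lean`).  Everything here is
**proved**; no definitions, no named facts.

The tree computes the Morse index of a height function `ℓ ∘ f` at a Lefschetz critical point for
CLOSED total spaces `X` (charted on `ℝ⁴`, model `𝓡 4`) fibred over the round sphere `S²`
(`Literature.Topology.FourManifolds.isMCriticalPt_nondegenerate_morseIndex_comp_of_lefschetzChart`,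
`SimplifiedBrokenLefschetzMorseCharts.lean`, through the chart Hessian `hessianInChart` of a chart
of the maximal atlas).  Here the same statement is proved for a Lefschetz chart
`c : LefschetzChart I IB π p` of a map `π : Z → B` in the full generality of
`AchiralLefschetzFibration.lean`: `Z` a `C^∞` manifold over ANY model with corners `I` on `ℝ⁴`
(with or without boundary), `B` over any model `IB`.  The Lefschetz chart `φ` is valued in `ℝ⁴`,
not in the model space `H` of `Z`, so it is not a chart of the atlas of `Z`; instead the Hessian
of `ℓ ∘ π` at `p` (the tree's `mhessian`, read in the preferred extended chart at the INTERIOR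
point `p`, `MorseChartChangeInterior.lean`) is transported along the transition map
`τ = φ ∘ (extChartAt I p)⁻¹`, a `C^∞` map of `ℝ⁴` near `x₀ = extChartAt I p p` with injective
(hence invertible) derivative `L = Dτ(x₀)`:

* `LefschetzChart.isInteriorPoint` — a point with a Lefschetz chart is an interior point of `Z`
  (`φ⁻¹` is a differentiable map from the boundaryless `ℝ⁴` with onto differential at `φ p`);
* `LefschetzChart.mdifferentiableAt`, `LefschetzChart.isMCriticalPt_comp` — `π` is differentiable
  at `p` (it is `ψ⁻¹ ∘ (z₁ z₂) ∘ φ` near `p`) and `p` is a critical point of `ℓ ∘ π` for every `ℓ`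
  differentiable at `π p`;
* `LefschetzChart.mhessian_comp_apply_eq` — **the Hessian of `ℓ ∘ π` at `p`** is
  `(v, w) ↦ μ (z₁(L v) z₂(L w) + z₁(L w) z₂(L v))` with `μ = D(ℓ ∘ ψ⁻¹)(0)` (second-order chain
  rule at a critical point, Milnor 1963, §2, and `D²(z₁ z₂)`);
* `LefschetzChart.nondegenerate_mhessian_comp`, `LefschetzChart.morseIndex_comp` — hence, when
  `dℓ_{π p} ≠ 0` (so `μ ≠ 0`), **`p` is a nondegenerate critical point of `ℓ ∘ π` of Morse index
  `2`** (Sylvester's law through `L`, and the signature `(2, 2)` of the node form,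
  `sigNeg_of_forall_apply_eq_nodeForm`);
* `IsLefschetzCriticalPoint.isMCriticalPt_nondegenerate_morseIndex_comp` — the same from the
  predicate `IsLefschetzCriticalPoint I IB o π p pos` (either chirality).

* (appended) `mhessian_apply_self_nonpos_of_isLocalMax_of_isInteriorPoint` — the second-order
  condition at an INTERIOR local maximum over an arbitrary model with corners (twin of the tree's
  `mhessian_apply_self_nonneg_of_isLocalMin_of_isInteriorPoint`, `ImmersionOrientation.lean`);
  `LefschetzChart.contMDiffAt_map` (`π` is `C^∞` at `p`);
  `LefschetzChart.exists_mhessian_comp_apply_self_pos` / `_neg` — the Hessian of `ℓ ∘ π` at `p`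
  takes both signs — hence `LefschetzChart.not_isLocalMax_comp`, `LefschetzChart.not_isLocalMin_comp`
  (and the `IsLefschetzCriticalPoint` forms): **a Lefschetz point is never a local extremum of a
  height function regular at the critical value** (so, for a PALF onto the closed disc, the
  critical values lie in the OPEN disc: `Literature/Geometry/Symplectic/PALFHeightFunction.lean`).

## References

* J. Milnor, *Morse theory*, Ann. of Math. Studies 51 (1963), §2 (nondegenerate critical points,
  the Hessian in local coordinates, the index). [Milnor1963]
* A. Kas, *On the handlebody decomposition associated to a Lefschetz fibration*, Pacific J. Math.
  89 (1980), 89–104, Lemma 1.6, Thm. 1.7. [Kas1980]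
* R. E. Gompf, A. I. Stipsicz, *4-Manifolds and Kirby Calculus*, GSM 20 (1999), Def. 8.1.4, §8.2.
  [GompfStipsiczGSM1999]
-/

noncomputable section

open scoped Manifold ContDiff Topology
open Set Function Filter

namespace Literature.Topology.FourManifolds

namespace LefschetzChart

variable {H : Type*} [TopologicalSpace H] {I : ModelWithCorners ℝ (EuclideanSpace ℝ (Fin 4)) H}
  {Z : Type*} [TopologicalSpace Z] [ChartedSpace H Z]
  {EB HB : Type*} [NormedAddCommGroup EB] [NormedSpace ℝ EB] [TopologicalSpace HB]
  {IB : ModelWithCorners ℝ EB HB} {B : Type*} [TopologicalSpace B] [ChartedSpace HB B]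
  {π : Z → B} {p : Z} (c : LefschetzChart I IB π p)

include c

/-! ### First-order facts: interior point, differentiability, critical point -/

/-- The total-space chart of a Lefschetz chart is differentiable at `p`. [folklore] -/
theorem mdifferentiableAt_chart : MDifferentiableAt I (𝓡 4) c.φ p :=
  c.contMDiffAt.mdifferentiableAt (by simp)

/-- The inverse of the total-space chart is differentiable at `φ p`. [folklore] -/
theorem mdifferentiableAt_chart_symm : MDifferentiableAt (𝓡 4) I c.φ.symm (c.φ p) :=
  c.contMDiffAt_symm.mdifferentiableAt (by simp)

/-- `d(φ⁻¹)_{φ p} ∘ dφ_p = id`: differentiate `φ⁻¹ ∘ φ = id` near `p`. [folklore] -/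
theorem mfderiv_symm_comp_mfderiv :
    (mfderiv (𝓡 4) I c.φ.symm (c.φ p)).comp (mfderiv I (𝓡 4) c.φ p) =
      ContinuousLinearMap.id ℝ (TangentSpace I p) := by
  have hid : (c.φ.symm ∘ c.φ) =ᶠ[𝓝 p] id :=
    Filter.eventuallyEq_of_mem (c.φ.open_source.mem_nhds c.mem_source) fun q hq ↦ c.φ.left_inv hq
  rw [← mfderiv_comp p c.mdifferentiableAt_chart_symm c.mdifferentiableAt_chart, hid.mfderiv_eq,
    mfderiv_id]

/-- **A point with a Lefschetz chart is an interior point of the total space**: `p = φ⁻¹ (φ p)`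
is the value of the differentiable map `φ⁻¹` of the boundaryless `ℝ⁴`, whose differential at
`φ p` is onto (`mfderiv_symm_comp_mfderiv`), and such maps take values in the interior
(`MDifferentiableAt.isInteriorPoint_of_surjective_mfderiv`). [folklore] -/
theorem isInteriorPoint : I.IsInteriorPoint p := by
  have hsurj : Surjective (mfderiv (𝓡 4) I c.φ.symm (c.φ p)) := fun v =>
    ⟨mfderiv I (𝓡 4) c.φ p v, DFunLike.congr_fun c.mfderiv_symm_comp_mfderiv v⟩
  have h := c.mdifferentiableAt_chart_symm.isInteriorPoint_of_surjective_mfderiv hsurj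
    BoundarylessManifold.isInteriorPoint
  rwa [c.φ.left_inv c.mem_source] at h

/-- **`π` is differentiable at a point with a Lefschetz chart**: near `p`,
`π = ψ⁻¹ ∘ (z₁ z₂) ∘ φ` (`LefschetzChart.eventuallyEq`). [folklore] -/
theorem mdifferentiableAt : MDifferentiableAt I IB π p := by
  have hnode : MDifferentiableAt (𝓡 4) 𝓘(ℝ, ℂ) lefschetzNodeMap (c.φ p) :=
    mdifferentiableAt_iff_differentiableAt.2
      ((contDiff_lefschetzNodeMap.differentiable (by simp)).differentiableAt)
  have hψ : MDifferentiableAt 𝓘(ℝ, ℂ) IB c.ψ.symm (lefschetzNodeMap (c.φ p)) := by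
    rw [← c.node_eq p c.mem_source]
    exact c.contMDiffAt_base_symm.mdifferentiableAt (by simp)
  exact (hψ.comp p (hnode.comp p c.mdifferentiableAt_chart)).congr_of_eventuallyEq c.eventuallyEq

/-- **A Lefschetz point is a critical point of every height function `ℓ ∘ π`** (`ℓ`
differentiable at `π p`): `d(ℓ ∘ π)_p = dℓ_{π p} ∘ dπ_p = 0` (Milnor 1963, §2).
[cite: Milnor1963, §2] -/
theorem isMCriticalPt_comp {ℓ : B → ℝ} (hℓ : MDifferentiableAt IB 𝓘(ℝ, ℝ) ℓ (π p)) :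
    IsMCriticalPt I (ℓ ∘ π) p := by
  unfold IsMCriticalPt
  rw [mfderiv_comp p hℓ c.mdifferentiableAt, c.mfderiv_eq_zero, ContinuousLinearMap.comp_zero]
  rfl

/-! ### The transition map `τ = φ ∘ (extChartAt I p)⁻¹` and its inverse `σ` -/

section Transition

/-- `τ x₀ = φ p`. [folklore] -/
theorem transition_apply : (c.φ ∘ (extChartAt I p).symm) (extChartAt I p p) = c.φ p := by
  simp only [Function.comp_apply, extChartAt_to_inv]

/-- Near `x₀`, the inverse extended chart lands in the domain of `φ`. [folklore] -/
theorem eventually_extChartAt_symm_mem_source :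
    ∀ᶠ z in 𝓝 (extChartAt I p p), (extChartAt I p).symm z ∈ c.φ.source := by
  have hmem : c.φ.source ∈ 𝓝 ((extChartAt I p).symm (extChartAt I p p)) := by
    rw [extChartAt_to_inv]; exact c.φ.open_source.mem_nhds c.mem_source
  exact (continuousAt_extChartAt_symm p).preimage_mem_nhds hmem

/-- `ψ⁻¹ 0 = π p`. [folklore] -/
theorem base_symm_apply_zero : c.ψ.symm 0 = π p := by
  rw [← c.base_apply_eq_zero, c.ψ.left_inv c.apply_mem_source]

/-- The inverse transition `σ = (extChartAt I p) ∘ φ⁻¹ : ℝ⁴ → ℝ⁴` is `C^∞` at `φ p`. [folklore] -/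
theorem contDiffAt_transition_symm :
    ContDiffAt ℝ ∞ ((extChartAt I p) ∘ c.φ.symm) (c.φ p) := by
  have h2 : ContMDiffAt I 𝓘(ℝ, EuclideanSpace ℝ (Fin 4)) ∞ (extChartAt I p)
      (c.φ.symm (c.φ p)) := by
    rw [c.φ.left_inv c.mem_source]; exact contMDiffAt_extChartAt
  exact contMDiffAt_iff_contDiffAt.1 (h2.comp _ c.contMDiffAt_symm)

variable [IsManifold I ∞ Z]

/-- The inverse of the preferred extended chart at the interior point `p` is `C^∞` at
`x₀ = extChartAt I p p` (as a map of the whole model vector space: `range I` is a neighbourhood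
of `x₀`). [folklore] -/
theorem contMDiffAt_extChartAt_symm :
    ContMDiffAt 𝓘(ℝ, EuclideanSpace ℝ (Fin 4)) I ∞ (extChartAt I p).symm (extChartAt I p p) :=
  (contMDiffWithinAt_extChartAt_symm_range (n := ∞) p (mem_extChartAt_target p)).contMDiffAt
    (range_mem_nhds_isInteriorPoint c.isInteriorPoint)

/-- The transition map `τ = φ ∘ (extChartAt I p)⁻¹ : ℝ⁴ → ℝ⁴` is `C^∞` at `x₀`. [folklore] -/
theorem contDiffAt_transition :
    ContDiffAt ℝ ∞ (c.φ ∘ (extChartAt I p).symm) (extChartAt I p p) := by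
  have h2 : ContMDiffAt I (𝓡 4) ∞ c.φ ((extChartAt I p).symm (extChartAt I p p)) := by
    rw [extChartAt_to_inv]; exact c.contMDiffAt
  exact contMDiffAt_iff_contDiffAt.1 (h2.comp _ c.contMDiffAt_extChartAt_symm)

omit [IsManifold I ∞ Z] in
/-- `σ ∘ τ = id` near `x₀` (an interior point: the target of the extended chart is a
neighbourhood of `x₀`). [folklore] -/
theorem transition_symm_comp_transition_eventuallyEq :
    (((extChartAt I p) ∘ c.φ.symm) ∘ (c.φ ∘ (extChartAt I p).symm)) =ᶠ[𝓝 (extChartAt I p p)]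
      id := by
  have htarget : (extChartAt I p).target ∈ 𝓝 (extChartAt I p p) :=
    mem_interior_iff_mem_nhds.1 (I.isInteriorPoint_iff.1 c.isInteriorPoint)
  filter_upwards [htarget, c.eventually_extChartAt_symm_mem_source] with z hz hz'
  simp only [Function.comp_apply, id_eq]
  rw [c.φ.left_inv hz', (extChartAt I p).right_inv hz]

/-- `Dσ(φ p) ∘ Dτ(x₀) = id`. [folklore] -/
theorem fderiv_transition_symm_comp_fderiv_transition :
    (fderiv ℝ ((extChartAt I p) ∘ c.φ.symm) (c.φ p)).comp
        (fderiv ℝ (c.φ ∘ (extChartAt I p).symm) (extChartAt I p p)) =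
      ContinuousLinearMap.id ℝ (EuclideanSpace ℝ (Fin 4)) := by
  have hτd : DifferentiableAt ℝ (c.φ ∘ (extChartAt I p).symm) (extChartAt I p p) :=
    c.contDiffAt_transition.differentiableAt (by simp)
  have hσd : DifferentiableAt ℝ ((extChartAt I p) ∘ c.φ.symm)
      ((c.φ ∘ (extChartAt I p).symm) (extChartAt I p p)) := by
    rw [c.transition_apply]; exact c.contDiffAt_transition_symm.differentiableAt (by simp)
  rw [← c.transition_apply, ← fderiv_comp _ hσd hτd,
    c.transition_symm_comp_transition_eventuallyEq.fderiv_eq, fderiv_id]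

/-- **The derivative `L = Dτ(x₀)` of the transition map is injective** (it has the left
inverse `Dσ(φ p)`), hence a linear automorphism of `ℝ⁴`. [folklore] -/
theorem injective_fderiv_transition :
    Injective (fderiv ℝ (c.φ ∘ (extChartAt I p).symm) (extChartAt I p p)) := by
  intro v w h
  have key := fun u => DFunLike.congr_fun c.fderiv_transition_symm_comp_fderiv_transition u
  simp only [ContinuousLinearMap.comp_apply, ContinuousLinearMap.id_apply] at key
  rw [← key v, ← key w, h]

end Transition

/-! ### The Hessian of `ℓ ∘ π` at `p`, its nondegeneracy and its index -/

section Hessian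

variable [IsManifold I ∞ Z]

omit [IsManifold I ∞ Z] in
/-- `Λ = ℓ ∘ ψ⁻¹ : ℂ → ℝ` is `C^∞` at `0` when `ℓ` is `C^∞` at `π p`. [folklore] -/
theorem contMDiffAt_comp_base_symm {ℓ : B → ℝ} (hℓ : ContMDiffAt IB 𝓘(ℝ, ℝ) ∞ ℓ (π p)) :
    ContMDiffAt 𝓘(ℝ, ℂ) 𝓘(ℝ, ℝ) ∞ (ℓ ∘ c.ψ.symm) 0 := by
  have hψsymm : ContMDiffAt 𝓘(ℝ, ℂ) IB ∞ c.ψ.symm 0 := by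
    rw [← c.base_apply_eq_zero]; exact c.contMDiffAt_base_symm
  have hℓ' : ContMDiffAt IB 𝓘(ℝ, ℝ) ∞ ℓ (c.ψ.symm 0) := by rwa [c.base_symm_apply_zero]
  exact hℓ'.comp (0 : ℂ) hψsymm

omit [IsManifold I ∞ Z] in
/-- `Λ = ℓ ∘ ψ⁻¹` is `C²` at `(z₁ z₂)(0) = 0` (the form consumed by
`fderiv_fderiv_comp_lefschetzNodeMap_apply`). [folklore] -/
theorem contDiffAt_comp_base_symm {ℓ : B → ℝ} (hℓ : ContMDiffAt IB 𝓘(ℝ, ℝ) ∞ ℓ (π p)) :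
    ContDiffAt ℝ 2 (ℓ ∘ c.ψ.symm) (lefschetzNodeMap 0) := by
  rw [lefschetzNodeMap_zero]
  exact (contMDiffAt_iff_contDiffAt.1 (c.contMDiffAt_comp_base_symm hℓ)).of_le (by norm_cast)

omit [IsManifold I ∞ Z] in
/-- **`μ = D(ℓ ∘ ψ⁻¹)(0) ≠ 0` when `dℓ_{π p} ≠ 0`**: near `π p`, `ℓ = (ℓ ∘ ψ⁻¹) ∘ ψ`, so
`dℓ_{π p} = μ ∘ dψ_{π p}`. [folklore] -/
theorem fderiv_comp_base_symm_ne_zero {ℓ : B → ℝ} (hℓ : ContMDiffAt IB 𝓘(ℝ, ℝ) ∞ ℓ (π p))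
    (hℓp : mfderiv IB 𝓘(ℝ, ℝ) ℓ (π p) ≠ 0) : fderiv ℝ (ℓ ∘ c.ψ.symm) 0 ≠ 0 := by
  intro hzero
  apply hℓp
  have heqℓ : ℓ =ᶠ[𝓝 (π p)] (ℓ ∘ c.ψ.symm) ∘ c.ψ :=
    Filter.eventuallyEq_of_mem (c.ψ.open_source.mem_nhds c.apply_mem_source) fun b hb => by
      simp only [Function.comp_apply, c.ψ.left_inv hb]
  have hψd : MDifferentiableAt IB 𝓘(ℝ, ℂ) c.ψ (π p) :=
    ((c.contMDiffOn_base _ c.apply_mem_source).contMDiffAt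
      (c.ψ.open_source.mem_nhds c.apply_mem_source)).mdifferentiableAt (by simp)
  have hΛd : MDifferentiableAt 𝓘(ℝ, ℂ) 𝓘(ℝ, ℝ) (ℓ ∘ c.ψ.symm) (c.ψ (π p)) := by
    rw [c.base_apply_eq_zero]
    exact (c.contMDiffAt_comp_base_symm hℓ).mdifferentiableAt (by simp)
  have key : mfderiv IB 𝓘(ℝ, ℝ) ℓ (π p) =
      (mfderiv 𝓘(ℝ, ℂ) 𝓘(ℝ, ℝ) (ℓ ∘ c.ψ.symm) (c.ψ (π p))).comp (mfderiv IB 𝓘(ℝ, ℂ) c.ψ (π p)) := by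
    rw [heqℓ.mfderiv_eq, mfderiv_comp (π p) hΛd hψd]
  have hm0 : mfderiv 𝓘(ℝ, ℂ) 𝓘(ℝ, ℝ) (ℓ ∘ c.ψ.symm) (c.ψ (π p)) = 0 := by
    rw [c.base_apply_eq_zero, mfderiv_eq_fderiv]; exact hzero
  rw [key, hm0]
  exact ContinuousLinearMap.zero_comp _

omit [IsManifold I ∞ Z] in
/-- Near `x₀`, the height function written in the preferred extended chart at `p` factors as
`(ℓ ∘ ψ⁻¹) ∘ (z₁ z₂) ∘ τ`. [folklore] -/
theorem writtenInExtChartAt_comp_eventuallyEq (ℓ : B → ℝ) :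
    writtenInExtChartAt I 𝓘(ℝ, ℝ) p (ℓ ∘ π) =ᶠ[𝓝 (extChartAt I p p)]
      ((ℓ ∘ c.ψ.symm) ∘ lefschetzNodeMap) ∘ (c.φ ∘ (extChartAt I p).symm) := by
  filter_upwards [c.eventually_extChartAt_symm_mem_source] with z hz
  simp only [writtenInExtChartAt, Function.comp_apply, extChartAt_self_apply,
    modelWithCornersSelf_coe, id_eq]
  rw [c.apply_eq hz]

/-- **The Hessian of a height function at a Lefschetz point** (Milnor 1963, §2 — the Hessian in
local coordinates and the second-order chain rule at a critical point — in the chart of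
Gompf–Stipsicz 1999, Def. 8.1.4): for `ℓ` smooth at `π p`,
`Hess_p(ℓ ∘ π)(v, w) = μ (z₁(L v) z₂(L w) + z₁(L w) z₂(L v))`, where `μ = D(ℓ ∘ ψ⁻¹)(0)`,
`L = D(φ ∘ (extChartAt I p)⁻¹)(x₀)` and `z₁ = x₀ + i x₁`, `z₂ = x₂ + i x₃` on `ℝ⁴ = ℂ²`.
[cite: Milnor1963, §2] -/
theorem mhessian_comp_apply_eq {ℓ : B → ℝ} (hℓ : ContMDiffAt IB 𝓘(ℝ, ℝ) ∞ ℓ (π p))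
    (v w : EuclideanSpace ℝ (Fin 4)) :
    mhessian I (ℓ ∘ π) p v w =
      fderiv ℝ (ℓ ∘ c.ψ.symm) 0
        ((⟨fderiv ℝ (c.φ ∘ (extChartAt I p).symm) (extChartAt I p p) v 0,
            fderiv ℝ (c.φ ∘ (extChartAt I p).symm) (extChartAt I p p) v 1⟩ : ℂ) *
          ⟨fderiv ℝ (c.φ ∘ (extChartAt I p).symm) (extChartAt I p p) w 2,
            fderiv ℝ (c.φ ∘ (extChartAt I p).symm) (extChartAt I p p) w 3⟩ +
        (⟨fderiv ℝ (c.φ ∘ (extChartAt I p).symm) (extChartAt I p p) w 0,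
            fderiv ℝ (c.φ ∘ (extChartAt I p).symm) (extChartAt I p p) w 1⟩ : ℂ) *
          ⟨fderiv ℝ (c.φ ∘ (extChartAt I p).symm) (extChartAt I p p) v 2,
            fderiv ℝ (c.φ ∘ (extChartAt I p).symm) (extChartAt I p p) v 3⟩) := by
  set G : EuclideanSpace ℝ (Fin 4) → ℝ := (ℓ ∘ c.ψ.symm) ∘ lefschetzNodeMap with hG
  have hτ0 : (c.φ ∘ (extChartAt I p).symm) (extChartAt I p p) = 0 := by
    rw [c.transition_apply, c.apply_eq_zero]
  have hΛ : ContDiffAt ℝ 2 (ℓ ∘ c.ψ.symm) (lefschetzNodeMap 0) := c.contDiffAt_comp_base_symm hℓ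
  have hnode : ContDiffAt ℝ 2 lefschetzNodeMap 0 :=
    (contDiff_lefschetzNodeMap.of_le (by norm_cast)).contDiffAt
  have hGc : ContDiffAt ℝ 2 G ((c.φ ∘ (extChartAt I p).symm) (extChartAt I p p)) := by
    rw [hτ0, hG]; exact hΛ.comp 0 hnode
  have hcrit : fderiv ℝ G ((c.φ ∘ (extChartAt I p).symm) (extChartAt I p p)) = 0 := by
    rw [hτ0, hG, fderiv_comp 0 (hΛ.differentiableAt (by norm_num))
      (hnode.differentiableAt (by norm_num)), hasFDerivAt_lefschetzNodeMap_zero.fderiv,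
      ContinuousLinearMap.comp_zero]
  rw [mhessian_apply_eq_fderiv_fderiv_of_isInteriorPoint' c.isInteriorPoint,
    ((c.writtenInExtChartAt_comp_eventuallyEq ℓ).fderiv).fderiv_eq,
    fderiv_fderiv_comp_apply_of_fderiv_eq_zero hGc (c.contDiffAt_transition.of_le (by norm_cast)) hcrit
      v w, hτ0, hG, fderiv_fderiv_comp_lefschetzNodeMap_apply hΛ]

/-- The data of the congruence: a linear automorphism `L` of `ℝ⁴`, the node form `B` of a
nonzero real linear form `μ` on `ℂ`, and `Hess_p(ℓ ∘ π)(v, w) = B (L v, L w)`. [folklore] -/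
theorem exists_mhessian_comp_eq_nodeForm {ℓ : B → ℝ} (hℓ : ContMDiffAt IB 𝓘(ℝ, ℝ) ∞ ℓ (π p))
    (hℓp : mfderiv IB 𝓘(ℝ, ℝ) ℓ (π p) ≠ 0) :
    ∃ (L : EuclideanSpace ℝ (Fin 4) ≃ₗ[ℝ] EuclideanSpace ℝ (Fin 4))
      (Bf : LinearMap.BilinForm ℝ (EuclideanSpace ℝ (Fin 4))) (μ : ℂ →L[ℝ] ℝ), μ ≠ 0 ∧
      (∀ v w, Bf v w = μ ((⟨v 0, v 1⟩ : ℂ) * ⟨w 2, w 3⟩ + ⟨w 0, w 1⟩ * ⟨v 2, v 3⟩)) ∧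
      ∀ v w, mhessian I (ℓ ∘ π) p v w = Bf (L v) (L w) := by
  set Lm := fderiv ℝ (c.φ ∘ (extChartAt I p).symm) (extChartAt I p p) with hLm
  set μ : ℂ →L[ℝ] ℝ := fderiv ℝ (ℓ ∘ c.ψ.symm) 0 with hμdef
  refine ⟨LinearEquiv.ofInjectiveEndo Lm.toLinearMap c.injective_fderiv_transition,
    LinearMap.mk₂ ℝ (fun v w => μ ((⟨v 0, v 1⟩ : ℂ) * ⟨w 2, w 3⟩ + ⟨w 0, w 1⟩ * ⟨v 2, v 3⟩))
      ?_ ?_ ?_ ?_, μ, c.fderiv_comp_base_symm_ne_zero hℓ hℓp, fun v w => rfl, fun v w => ?_⟩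
  · intro v v' w
    rw [← map_add]; congr 1
    simp only [PiLp.add_apply]
    apply Complex.ext <;> simp <;> ring
  · intro a v w
    rw [smul_eq_mul, ← smul_eq_mul a (μ _), ← map_smul]; congr 1
    simp only [PiLp.smul_apply, smul_eq_mul, Complex.real_smul]
    apply Complex.ext <;> simp <;> ring
  · intro v w w'
    rw [← map_add]; congr 1
    simp only [PiLp.add_apply]
    apply Complex.ext <;> simp <;> ring
  · intro a v w
    rw [smul_eq_mul, ← smul_eq_mul a (μ _), ← map_smul]; congr 1
    simp only [PiLp.smul_apply, smul_eq_mul, Complex.real_smul]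
    apply Complex.ext <;> simp <;> ring
  · rw [c.mhessian_comp_apply_eq hℓ v w]
    rfl

/-- **A Lefschetz point is a NONDEGENERATE critical point of every height function regular at
the critical value** (Milnor 1963, §2): if `ℓ` is smooth at `π p` with `dℓ_{π p} ≠ 0` then the
Hessian of `ℓ ∘ π` at `p` is nondegenerate (it is congruent to the node form of the nonzero
linear form `μ = D(ℓ ∘ ψ⁻¹)(0)`, `nondegenerate_of_forall_apply_eq_nodeForm`).
[cite: Milnor1963, §2] -/
theorem nondegenerate_mhessian_comp {ℓ : B → ℝ} (hℓ : ContMDiffAt IB 𝓘(ℝ, ℝ) ∞ ℓ (π p))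
    (hℓp : mfderiv IB 𝓘(ℝ, ℝ) ℓ (π p) ≠ 0) : (mhessian I (ℓ ∘ π) p).Nondegenerate := by
  obtain ⟨L, Bf, μ, hμ, hB, h⟩ := c.exists_mhessian_comp_eq_nodeForm hℓ hℓp
  exact (nondegenerate_iff_of_forall_apply_eq L h).2 (nondegenerate_of_forall_apply_eq_nodeForm Bf hμ hB)

/-- **A Lefschetz point has Morse index `2` for every height function regular at the critical
value** (Milnor 1963, §2; Kas 1980, Lemma 1.6 / Gompf–Stipsicz 1999, §8.2: each Lefschetz
singular point is passed by attaching one `2`-handle): if `ℓ` is smooth at `π p` with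
`dℓ_{π p} ≠ 0` then `morseIndex I (ℓ ∘ π) p = 2` (Sylvester's law through `L` and the signature
`(2, 2)` of the node form, `sigNeg_of_forall_apply_eq_nodeForm`).
[cite: Milnor1963, §2] [cite: Kas1980, Lemma 1.6] -/
theorem morseIndex_comp {ℓ : B → ℝ} (hℓ : ContMDiffAt IB 𝓘(ℝ, ℝ) ∞ ℓ (π p))
    (hℓp : mfderiv IB 𝓘(ℝ, ℝ) ℓ (π p) ≠ 0) : morseIndex I (ℓ ∘ π) p = 2 := by
  obtain ⟨L, Bf, μ, hμ, hB, h⟩ := c.exists_mhessian_comp_eq_nodeForm hℓ hℓp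
  unfold morseIndex
  rw [sigNeg_eq_of_forall_apply_eq L h]
  exact sigNeg_of_forall_apply_eq_nodeForm Bf hμ hB

/-- The three conclusions together: **a Lefschetz point is a nondegenerate critical point of
index `2` of `ℓ ∘ π`** whenever `ℓ` is smooth at `π p` with `dℓ_{π p} ≠ 0`.
[cite: Milnor1963, §2] -/
theorem isMCriticalPt_nondegenerate_morseIndex_comp {ℓ : B → ℝ}
    (hℓ : ContMDiffAt IB 𝓘(ℝ, ℝ) ∞ ℓ (π p)) (hℓp : mfderiv IB 𝓘(ℝ, ℝ) ℓ (π p) ≠ 0) :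
    IsMCriticalPt I (ℓ ∘ π) p ∧ (mhessian I (ℓ ∘ π) p).Nondegenerate ∧
      morseIndex I (ℓ ∘ π) p = 2 :=
  ⟨c.isMCriticalPt_comp (hℓ.mdifferentiableAt (by simp)), c.nondegenerate_mhessian_comp hℓ hℓp,
    c.morseIndex_comp hℓ hℓp⟩

end Hessian

end LefschetzChart

/-! ### From the predicate `IsLefschetzCriticalPoint` -/

section Predicate

variable {H : Type*} [TopologicalSpace H] {I : ModelWithCorners ℝ (EuclideanSpace ℝ (Fin 4)) H}
  {Z : Type*} [TopologicalSpace Z] [ChartedSpace H Z] [IsManifold I ∞ Z]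
  {EB HB : Type*} [NormedAddCommGroup EB] [NormedSpace ℝ EB] [TopologicalSpace HB]
  {IB : ModelWithCorners ℝ EB HB} {B : Type*} [TopologicalSpace B] [ChartedSpace HB B]
  {o : SmoothOrientation I Z} {π : Z → B} {p : Z} {pos : Bool}

/-- A Lefschetz critical point (of either chirality) is an interior point. [folklore] -/
theorem IsLefschetzCriticalPoint.isInteriorPoint (h : IsLefschetzCriticalPoint I IB o π p pos) :
    I.IsInteriorPoint p :=
  let ⟨c, _⟩ := h; c.isInteriorPoint

/-- `π` is differentiable at a Lefschetz critical point. [folklore] -/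
theorem IsLefschetzCriticalPoint.mdifferentiableAt (h : IsLefschetzCriticalPoint I IB o π p pos) :
    MDifferentiableAt I IB π p :=
  let ⟨c, _⟩ := h; c.mdifferentiableAt

/-- **A Lefschetz critical point (of either chirality) is a nondegenerate critical point of
index `2` of every height function `ℓ ∘ π` with `ℓ` smooth at `π p` and `dℓ_{π p} ≠ 0`**
(Milnor 1963, §2; Kas 1980, Lemma 1.6). [cite: Milnor1963, §2] [cite: Kas1980, Lemma 1.6] -/
theorem IsLefschetzCriticalPoint.isMCriticalPt_nondegenerate_morseIndex_comp
    (h : IsLefschetzCriticalPoint I IB o π p pos) {ℓ : B → ℝ}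
    (hℓ : ContMDiffAt IB 𝓘(ℝ, ℝ) ∞ ℓ (π p)) (hℓp : mfderiv IB 𝓘(ℝ, ℝ) ℓ (π p) ≠ 0) :
    IsMCriticalPt I (ℓ ∘ π) p ∧ (mhessian I (ℓ ∘ π) p).Nondegenerate ∧
      morseIndex I (ℓ ∘ π) p = 2 :=
  let ⟨c, _⟩ := h; c.isMCriticalPt_nondegenerate_morseIndex_comp hℓ hℓp

end Predicate

/-! ### Local extrema at interior points (any model with corners) -/

section InteriorExtrema

variable {E H : Type*} [NormedAddCommGroup E] [NormedSpace ℝ E] [TopologicalSpace H]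
  {I : ModelWithCorners ℝ E H} {M : Type*} [TopologicalSpace M] [ChartedSpace H M]

/-- **The Hessian at an interior local maximum is negative semidefinite** (`f` of class `C²`
at the point; Milnor 1963, §2; any model with corners — the twin of the tree's
`mhessian_apply_self_nonneg_of_isLocalMin_of_isInteriorPoint`, `ImmersionOrientation.lean`, and
of the boundaryless `IsLocalMin.mhessian_apply_self_nonneg`, `MorseExtrema.lean`; Fermat at an
interior point is the tree's `isMCriticalPt_of_isLocalMax`, `SPC4HandleChainProofs.lean`).
[cite: Milnor1963, §2] -/
theorem mhessian_apply_self_nonpos_of_isLocalMax_of_isInteriorPoint {f : M → ℝ} {x : M}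
    (hf : ContMDiffAt I 𝓘(ℝ, ℝ) 2 f x) (h : IsLocalMax f x) (hx : I.IsInteriorPoint x) (v : E) :
    mhessian I f x v v ≤ 0 := by
  have h2 : ContDiffAt ℝ 2 (writtenInExtChartAt I 𝓘(ℝ, ℝ) x f) (extChartAt I x x) :=
    (contMDiffAt_iff.1 hf).2.contDiffAt (range_mem_nhds_isInteriorPoint hx)
  rw [mhessian_apply_eq_fderiv_fderiv_of_isInteriorPoint' hx]
  exact IsLocalMax.fderiv_fderiv_apply_self_nonpos h2 (isLocalMax_writtenInExtChartAt h) v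

end InteriorExtrema

/-! ### A Lefschetz point is not a local extremum of a height function -/

namespace LefschetzChart

variable {H : Type*} [TopologicalSpace H] {I : ModelWithCorners ℝ (EuclideanSpace ℝ (Fin 4)) H}
  {Z : Type*} [TopologicalSpace Z] [ChartedSpace H Z]
  {EB HB : Type*} [NormedAddCommGroup EB] [NormedSpace ℝ EB] [TopologicalSpace HB]
  {IB : ModelWithCorners ℝ EB HB} {B : Type*} [TopologicalSpace B] [ChartedSpace HB B]
  {π : Z → B} {p : Z} (c : LefschetzChart I IB π p)

include c

/-- **`π` is `C^∞` at a point with a Lefschetz chart**: near `p`, `π = ψ⁻¹ ∘ (z₁ z₂) ∘ φ`.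
[folklore] -/
theorem contMDiffAt_map : ContMDiffAt I IB ∞ π p := by
  have hnode : ContMDiffAt (𝓡 4) 𝓘(ℝ, ℂ) ∞ lefschetzNodeMap (c.φ p) :=
    (contMDiff_iff_contDiff.2 contDiff_lefschetzNodeMap) (c.φ p)
  have hψ : ContMDiffAt 𝓘(ℝ, ℂ) IB ∞ c.ψ.symm (lefschetzNodeMap (c.φ p)) := by
    rw [← c.node_eq p c.mem_source]
    exact c.contMDiffAt_base_symm
  exact (hψ.comp p (hnode.comp p c.contMDiffAt)).congr_of_eventuallyEq c.eventuallyEq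

omit c in
/-- A nonzero real linear form on `ℂ` takes a positive value. [folklore] -/
theorem exists_apply_pos_of_ne_zero {μ : ℂ →L[ℝ] ℝ} (hμ : μ ≠ 0) : ∃ ζ : ℂ, 0 < μ ζ := by
  by_contra hneg
  push Not at hneg
  apply hμ
  ext ζ
  have h1 := hneg ζ
  have h2 := hneg (-ζ)
  rw [map_neg] at h2
  change μ ζ = 0
  linarith

variable [IsManifold I ∞ Z]

/-- **The Hessian of a height function at a Lefschetz point takes a positive value** (on the
vector `L⁻¹ (ζ, 1)` with `μ ζ > 0`: the node form gives `μ (2 ζ)`). [cite: Milnor1963, §2] -/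
theorem exists_mhessian_comp_apply_self_pos {ℓ : B → ℝ} (hℓ : ContMDiffAt IB 𝓘(ℝ, ℝ) ∞ ℓ (π p))
    (hℓp : mfderiv IB 𝓘(ℝ, ℝ) ℓ (π p) ≠ 0) : ∃ v, 0 < mhessian I (ℓ ∘ π) p v v := by
  obtain ⟨L, Bf, μ, hμ, hB, h⟩ := c.exists_mhessian_comp_eq_nodeForm hℓ hℓp
  obtain ⟨ζ, hζ⟩ := exists_apply_pos_of_ne_zero hμ
  set v : EuclideanSpace ℝ (Fin 4) := WithLp.toLp 2 ![ζ.re, ζ.im, 1, 0] with hv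
  have key : ((⟨v 0, v 1⟩ : ℂ) * ⟨v 2, v 3⟩ + ⟨v 0, v 1⟩ * ⟨v 2, v 3⟩) = ζ + ζ := by
    apply Complex.ext <;> simp [hv, Complex.mul_re, Complex.mul_im]
  refine ⟨L.symm v, ?_⟩
  rw [h, LinearEquiv.apply_symm_apply, hB, key, map_add]
  linarith

/-- … and a negative value (on `L⁻¹ (ζ, -1)`). [cite: Milnor1963, §2] -/
theorem exists_mhessian_comp_apply_self_neg {ℓ : B → ℝ} (hℓ : ContMDiffAt IB 𝓘(ℝ, ℝ) ∞ ℓ (π p))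
    (hℓp : mfderiv IB 𝓘(ℝ, ℝ) ℓ (π p) ≠ 0) : ∃ v, mhessian I (ℓ ∘ π) p v v < 0 := by
  obtain ⟨L, Bf, μ, hμ, hB, h⟩ := c.exists_mhessian_comp_eq_nodeForm hℓ hℓp
  obtain ⟨ζ, hζ⟩ := exists_apply_pos_of_ne_zero hμ
  set v : EuclideanSpace ℝ (Fin 4) := WithLp.toLp 2 ![ζ.re, ζ.im, -1, 0] with hv
  have key : ((⟨v 0, v 1⟩ : ℂ) * ⟨v 2, v 3⟩ + ⟨v 0, v 1⟩ * ⟨v 2, v 3⟩) = -ζ + -ζ := by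
    apply Complex.ext <;> simp [hv, Complex.mul_re, Complex.mul_im]
  refine ⟨L.symm v, ?_⟩
  rw [h, LinearEquiv.apply_symm_apply, hB, key, map_add, map_neg]
  linarith

/-- **A Lefschetz point is not a local maximum of a height function regular at the critical
value** (the Hessian there is not negative semidefinite; Milnor 1963, §2 — the index is `2`, not
`4`). [cite: Milnor1963, §2] -/
theorem not_isLocalMax_comp {ℓ : B → ℝ} (hℓ : ContMDiffAt IB 𝓘(ℝ, ℝ) ∞ ℓ (π p))
    (hℓp : mfderiv IB 𝓘(ℝ, ℝ) ℓ (π p) ≠ 0) : ¬ IsLocalMax (ℓ ∘ π) p := by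
  intro hmax
  obtain ⟨v, hv⟩ := c.exists_mhessian_comp_apply_self_pos hℓ hℓp
  have hg : ContMDiffAt I 𝓘(ℝ, ℝ) 2 (ℓ ∘ π) p :=
    (hℓ.comp p c.contMDiffAt_map).of_le (by norm_cast)
  have h := mhessian_apply_self_nonpos_of_isLocalMax_of_isInteriorPoint hg hmax c.isInteriorPoint v
  linarith

/-- **A Lefschetz point is not a local minimum of a height function regular at the critical
value** (the index is `2`, not `0`). [cite: Milnor1963, §2] -/
theorem not_isLocalMin_comp {ℓ : B → ℝ} (hℓ : ContMDiffAt IB 𝓘(ℝ, ℝ) ∞ ℓ (π p))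
    (hℓp : mfderiv IB 𝓘(ℝ, ℝ) ℓ (π p) ≠ 0) : ¬ IsLocalMin (ℓ ∘ π) p := by
  intro hmin
  -- turn about: `p` would be a local maximum of `(0 - ℓ) ∘ π`
  have hmax : IsLocalMax ((fun b => 0 - ℓ b) ∘ π) p := by
    have h := hmin.neg
    simp only [Function.comp_apply] at h
    simpa only [Function.comp_def, zero_sub] using h
  have hℓ' : ContMDiffAt IB 𝓘(ℝ, ℝ) ∞ (fun b => 0 - ℓ b) (π p) := contMDiffAt_const.sub hℓ
  have hℓp' : mfderiv IB 𝓘(ℝ, ℝ) (fun b => 0 - ℓ b) (π p) ≠ 0 := by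
    rw [mfderiv_const_sub 0 (hℓ.mdifferentiableAt (by simp))]
    exact neg_ne_zero.2 hℓp
  exact c.not_isLocalMax_comp hℓ' hℓp' hmax

end LefschetzChart

section PredicateExtrema

variable {H : Type*} [TopologicalSpace H] {I : ModelWithCorners ℝ (EuclideanSpace ℝ (Fin 4)) H}
  {Z : Type*} [TopologicalSpace Z] [ChartedSpace H Z] [IsManifold I ∞ Z]
  {EB HB : Type*} [NormedAddCommGroup EB] [NormedSpace ℝ EB] [TopologicalSpace HB]
  {IB : ModelWithCorners ℝ EB HB} {B : Type*} [TopologicalSpace B] [ChartedSpace HB B]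
  {o : SmoothOrientation I Z} {π : Z → B} {p : Z} {pos : Bool}

/-- `π` is `C^∞` at a Lefschetz critical point. [folklore] -/
theorem IsLefschetzCriticalPoint.contMDiffAt (h : IsLefschetzCriticalPoint I IB o π p pos) :
    ContMDiffAt I IB ∞ π p :=
  let ⟨c, _⟩ := h; c.contMDiffAt_map

/-- **A Lefschetz critical point (of either chirality) is neither a local maximum nor a local
minimum of a height function `ℓ ∘ π` with `ℓ` smooth at `π p` and `dℓ_{π p} ≠ 0`.**
[cite: Milnor1963, §2] -/
theorem IsLefschetzCriticalPoint.not_isLocalMax_not_isLocalMin_comp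
    (h : IsLefschetzCriticalPoint I IB o π p pos) {ℓ : B → ℝ}
    (hℓ : ContMDiffAt IB 𝓘(ℝ, ℝ) ∞ ℓ (π p)) (hℓp : mfderiv IB 𝓘(ℝ, ℝ) ℓ (π p) ≠ 0) :
    ¬ IsLocalMax (ℓ ∘ π) p ∧ ¬ IsLocalMin (ℓ ∘ π) p :=
  let ⟨c, _⟩ := h; ⟨c.not_isLocalMax_comp hℓ hℓp, c.not_isLocalMin_comp hℓ hℓp⟩

end PredicateExtrema

end Literature.Topology.FourManifolds

end
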